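import Mathlib
import Summits.NavierStokesRegularity.NavierStokesRegularity.Theorems.FrozenSignCascadeTightEnvelopeContinuationConvolution
import HarnessLib

/-!
# Route FrozenSignCascade · item `TightEnvelopeContinuation` — helper 3: order-4 weights from a
  tight critical envelope and the energy

Helper file for statement item stmt-NavierStokesRegularity-10580 (`TightEnvelopeContinuation`,
support of route `FrozenSignCascade`); lands `--supports` that item.

**The a-priori bound.** Let `V` be a Fourier-side mild solution of Navier–Stokes on `[0, F]`
(`FourierNS.IsFourierMild c 4 0 F V`, frequency space `ℝ³`), `F ≤ T_w`, with

* energy `∫ ‖V(r, η)‖² dη ≤ Λ` on `[0, F]` (Leray's energy inequality through Plancherel),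
* a **tight critical envelope** of radius `R ≥ 1` at level `ε`: `‖ζ‖² ‖V(r, ζ)‖ ≤ ε` for `‖ζ‖ ≥ R`,
  where `ε` is small against the heat rate, `13824 π ε · 3|B₁| ≤ c`,
* initial weight `‖V(0, ξ)‖ ≤ A₀ (1+‖ξ‖)⁻⁴`.

Then the order-`4` weights of `V(r)` are bounded on `[0, F]` by an explicit constant depending on
`(c, T_w, Λ, R, A₀)` only (`hasDecay_four_of_tight`). Proof: a high/low frequency bootstrap. At low
frequencies the Duhamel formula and the energy bound of the convolution give
`‖V(r, ξ)‖ ≤ A₀ + 36π ‖ξ‖ Λ r` (`norm_le_of_energy`). At a high frequency `‖ξ‖ ≥ R₁ ≥ 2R` the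
convolution bound of the previous helper (`norm_fconv_le_of_tight`, with the finite supremum `Φ`
of the weights), the symbol bound `36π‖ξ‖` and the heat integral `(c‖ξ‖²)⁻¹` make the Duhamel
term at order `4` at most `Φ/2` (`absorb_le_half`), and `Φ ≤ B + Φ/2` is absorbed. This is the
scale-critical (`PM²`-level) version of the propagation of the pseudo-measure weights
(Lemarié-Rieusset 2016, §8.5, Thm. 8.21 and its proof; Le Jan–Sznitman 1997), with tightness of
the tail replacing smallness of the norm.
-/

noncomputable section

set_option linter.dupNamespace false -- nested layout Summit.<S>.<Sub>, Sub = S (D-0017)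

open MeasureTheory Set Metric Real Filter
open scoped ENNReal
open Literature.Analysis.FluidPDE.FourierNS

namespace Summit.NavierStokesRegularity.NavierStokesRegularity.Theorems.TightEnvelope

/-! ### Low frequencies: the pointwise bound from the energy -/

variable {c F : ℝ} {V : ℝ → EuclideanSpace ℝ (Fin 3) → Fin 3 → ℂ}

/-- The real energy of a slice from the `ℝ≥0∞`-valued energy bound. -/
theorem integral_norm_sq_le_of_lintegral (h : IsFourierMild c 4 0 F V) {Λ : ℝ} (hΛ : 0 ≤ Λ)
    {r : ℝ} (hE : ∫⁻ η, ‖V r η‖ₑ ^ 2 ≤ ENNReal.ofReal Λ) : ∫ η, ‖V r η‖ ^ 2 ≤ Λ := by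
  have h1 : ∫ η, ‖V r η‖ ^ 2 = (∫⁻ η, ‖V r η‖ₑ ^ 2).toReal := by
    rw [integral_eq_lintegral_of_nonneg_ae (Eventually.of_forall fun η => sq_nonneg _)
      ((h.continuous_slice r).norm.pow 2).aestronglyMeasurable]
    congr 1
    refine lintegral_congr fun η => ?_
    rw [← ofReal_norm, ENNReal.ofReal_pow (norm_nonneg _)]
  rw [h1]
  exact ENNReal.toReal_le_of_le_ofReal hΛ hE

/-- **The low-frequency bound.** For a Fourier-side mild solution on `[0, F]` with energy
`∫ ‖V(r)‖² ≤ Λ`, the Duhamel formula from time `0`, the symbol bound `36π‖ξ‖` and the energy bound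
`|(V_j ⋆ V_k)(ξ)| ≤ Λ` of the convolution give `‖V(r, ξ)‖ ≤ ‖V(0, ξ)‖ + 36π ‖ξ‖ Λ r`
(the bound `|N(V,V)(ξ)| ≲ |ξ| ‖u‖²_{L²}` of the card). -/
theorem norm_le_of_energy (h : IsFourierMild c 4 0 F V) {Λ : ℝ}
    (hE : ∀ r ∈ Icc 0 F, ∫ η, ‖V r η‖ ^ 2 ≤ Λ) {r : ℝ} (hr : r ∈ Icc 0 F)
    (ξ : EuclideanSpace ℝ (Fin 3)) : ‖V r ξ‖ ≤ ‖V 0 ξ‖ + 36 * π * ‖ξ‖ * Λ * r := by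
  have hc := h.hc
  obtain ⟨A, -, hA⟩ := h.decay₀
  have hΛ : 0 ≤ Λ := le_trans (integral_nonneg fun η => sq_nonneg _) (hE 0 ⟨le_rfl, h.le⟩)
  have hconv : ∀ r' ∈ Icc 0 F, ∀ j k, ‖fconv (V r' · j) (V r' · k) ξ‖ ≤ Λ := fun r' hr' j k =>
    (norm_fconv_le_integral_norm_sq (integrable_norm_sq_of_hasDecay h.hK₀ (hA r')
      (h.aestronglyMeasurable_slice r')) j k ξ).trans (hE r' hr')
  have hN : ∀ r' ∈ Icc 0 F, ‖nonlin (V r') (V r') ξ‖ ≤ 36 * π * ‖ξ‖ * Λ := fun r' hr' =>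
    norm_nonlin_le_of_fconv_le hΛ (hconv r' hr')
  set D : Fin 3 → ℂ := ∫ r' in (0 : ℝ)..r, heat c ξ (r - r') • nonlin (V r') (V r') ξ with hD
  have hVr : V r ξ = heat c ξ (r - 0) • V 0 ξ - D := h.duhamel le_rfl hr.1 hr.2 ξ
  have h1 : ‖V r ξ‖ ≤ ‖V 0 ξ‖ + ‖D‖ := by
    rw [hVr]
    calc ‖heat c ξ (r - 0) • V 0 ξ - D‖ ≤ ‖heat c ξ (r - 0) • V 0 ξ‖ + ‖D‖ := norm_sub_le _ _
      _ = heat c ξ (r - 0) * ‖V 0 ξ‖ + ‖D‖ := by rw [norm_heat_smul]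
      _ ≤ ‖V 0 ξ‖ + ‖D‖ := by
          gcongr
          exact mul_le_of_le_one_left (norm_nonneg _) (heat_le_one hc.le (by linarith [hr.1]) ξ)
  have h2 : ‖D‖ ≤ 36 * π * ‖ξ‖ * Λ * r := by
    have hD1 : ‖D‖ ≤ ∫ r' in (0 : ℝ)..r, heat c ξ (r - r') * ‖nonlin (V r') (V r') ξ‖ :=
      (intervalIntegral.norm_integral_le_integral_norm hr.1).trans_eq
        (intervalIntegral.integral_congr fun r' _ => by simp only [norm_heat_smul])
    have hcont1 : Continuous fun r' => heat c ξ (r - r') * ‖nonlin (V r') (V r') ξ‖ :=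
      (continuous_heat_comp c continuous_const (continuous_const.sub continuous_id)).mul
        (h.continuous_nonlin_time ξ).norm
    have hD2 : ∫ r' in (0 : ℝ)..r, heat c ξ (r - r') * ‖nonlin (V r') (V r') ξ‖ ≤
        ∫ _ in (0 : ℝ)..r, 36 * π * ‖ξ‖ * Λ := by
      refine intervalIntegral.integral_mono_on hr.1 (hcont1.intervalIntegrable _ _)
        (continuous_const.intervalIntegrable _ _) fun r' hr' => ?_
      calc heat c ξ (r - r') * ‖nonlin (V r') (V r') ξ‖ ≤ 1 * (36 * π * ‖ξ‖ * Λ) :=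
            mul_le_mul (heat_le_one hc.le (by linarith [hr'.2]) ξ)
              (hN r' ⟨hr'.1, hr'.2.trans hr.2⟩) (norm_nonneg _) zero_le_one
        _ = 36 * π * ‖ξ‖ * Λ := one_mul _
    rw [intervalIntegral.integral_const, smul_eq_mul] at hD2
    calc ‖D‖ ≤ _ := hD1
      _ ≤ (r - 0) * (36 * π * ‖ξ‖ * Λ) := hD2
      _ = 36 * π * ‖ξ‖ * Λ * r := by ring
  linarith

/-! ### The a-priori bound -/

/-- **Order-`4` weights from a tight critical envelope and the energy.** Let `V` be a
Fourier-side mild solution on `[0, F]`, `F ≤ T_w`, with energy `∫ ‖V(r)‖² ≤ Λ`, a tight critical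
envelope `‖ζ‖²‖V(r, ζ)‖ ≤ ε` for `‖ζ‖ ≥ R ≥ 1` at a level with `13824 π ε · 3|B₁| ≤ c`, and
initial weight `HasDecay 4 A₀ (V 0)`. Then for every radius `R₁ ≥ 2R` with
`4608 π (A₀ + 36π R Λ T_w) |B_R| ≤ c R₁`, all slices satisfy
`HasDecay 4 (2 (A₀ + (1+R₁)⁴ (A₀ + 36π R₁ Λ T_w))) (V r)`, `r ∈ [0, F]` — a bound independent of
`V` and `F`. High frequencies `‖ξ‖ ≥ R₁`: two-time Duhamel formula from `0`, `norm_fconv_le_of_tight`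
with the finite supremum `Φ` of the weights, `absorb_le_half`; low frequencies: `norm_le_of_energy`;
then `Φ ≤ B + Φ/2` is absorbed (Lemarié-Rieusset 2016, §8.5 / Thm. 8.21, with tightness of the
`PM²` tail in place of smallness). -/
theorem hasDecay_four_of_tight (h : IsFourierMild c 4 0 F V) {Tw Λ ε R R₁ A₀ : ℝ} (hFT : F ≤ Tw)
    (hΛ : 0 ≤ Λ) (hE : ∀ r ∈ Icc 0 F, ∫ η, ‖V r η‖ ^ 2 ≤ Λ) (hR : 1 ≤ R) (hε : 0 ≤ ε)
    (hεc : 13824 * π * ε * (3 * (volume (ball (0 : EuclideanSpace ℝ (Fin 3)) 1)).toReal) ≤ c)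
    (htight : ∀ r ∈ Icc 0 F, ∀ ζ, R ≤ ‖ζ‖ → ‖ζ‖ ^ 2 * ‖V r ζ‖ ≤ ε)
    (hA₀ : HasDecay 4 A₀ (V 0)) (hR₁ : 2 * R ≤ R₁)
    (hR₁' : 4608 * π * (A₀ + 36 * π * R * Λ * Tw) *
      (volume (ball (0 : EuclideanSpace ℝ (Fin 3)) R)).toReal ≤ c * R₁) :
    ∀ r ∈ Icc 0 F, HasDecay 4 (2 * (A₀ + (1 + R₁) ^ 4 * (A₀ + 36 * π * R₁ * Λ * Tw))) (V r) := by
  have hc := h.hc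
  have hA₀0 := hA₀.nonneg
  have hF0 : 0 ≤ F := h.le
  have hTw : 0 ≤ Tw := hF0.trans hFT
  have hR0 : 0 < R := by linarith
  have hR₁1 : 1 ≤ R₁ := by linarith
  set vB : ℝ := (volume (ball (0 : EuclideanSpace ℝ (Fin 3)) R)).toReal with hvB
  set CE : ℝ := 3 * (volume (ball (0 : EuclideanSpace ℝ (Fin 3)) 1)).toReal with hCE
  have hvB0 : 0 ≤ vB := ENNReal.toReal_nonneg
  have hCE0 : 0 ≤ CE := by positivity
  set M : ℝ := A₀ + 36 * π * R * Λ * Tw with hM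
  have hM0 : 0 ≤ M := by positivity
  set B : ℝ := A₀ + (1 + R₁) ^ 4 * (A₀ + 36 * π * R₁ * Λ * Tw) with hB
  have hB0 : 0 ≤ B := by positivity
  have hA₀B : A₀ ≤ B := by
    have : 0 ≤ (1 + R₁) ^ 4 * (A₀ + 36 * π * R₁ * Λ * Tw) := by positivity
    rw [hB]; linarith
  -- low-frequency pointwise bound
  have hlow : ∀ r ∈ Icc 0 F, ∀ ξ, ‖V r ξ‖ ≤ A₀ + 36 * π * ‖ξ‖ * Λ * Tw := by
    intro r hr ξ
    have h1 := norm_le_of_energy h hE hr ξ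
    have h2 : ‖V 0 ξ‖ ≤ A₀ := hA₀.norm_le ξ
    have h3 : 36 * π * ‖ξ‖ * Λ * r ≤ 36 * π * ‖ξ‖ * Λ * Tw :=
      mul_le_mul_of_nonneg_left (hr.2.trans hFT) (by positivity)
    linarith
  have hlowR : ∀ r ∈ Icc 0 F, ∀ ζ, ‖ζ‖ < R → ‖V r ζ‖ ≤ M := by
    intro r hr ζ hζ
    refine (hlow r hr ζ).trans ?_
    have : 36 * π * ‖ζ‖ * Λ * Tw ≤ 36 * π * R * Λ * Tw := by gcongr
    rw [hM]; linarith
  -- the finite supremum of the weighted norms over `[0, F]`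
  obtain ⟨AK, hAK⟩ := h.decay 4
  set Abar : ℝ≥0∞ := ⨆ r ∈ Icc 0 F, ⨆ ξ : EuclideanSpace ℝ (Fin 3),
    ENNReal.ofReal ((1 + ‖ξ‖) ^ 4 * ‖V r ξ‖) with hAbar
  have hAbar_le : Abar ≤ ENNReal.ofReal AK :=
    iSup₂_le fun r _ => iSup_le fun ξ => ENNReal.ofReal_le_ofReal (weight_mul_norm_le (hAK r) ξ)
  have hAbar_top : Abar ≠ ⊤ := ne_top_of_le_ne_top ENNReal.ofReal_ne_top hAbar_le
  set a : ℝ := Abar.toReal with ha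
  have ha0 : 0 ≤ a := ENNReal.toReal_nonneg
  have hle_Abar : ∀ r ∈ Icc 0 F, ∀ ξ, ENNReal.ofReal ((1 + ‖ξ‖) ^ 4 * ‖V r ξ‖) ≤ Abar := by
    intro r hr ξ
    refine le_trans ?_ (le_iSup₂ (f := fun r (_ : r ∈ Icc 0 F) => ⨆ ξ : EuclideanSpace ℝ (Fin 3),
      ENNReal.ofReal ((1 + ‖ξ‖) ^ 4 * ‖V r ξ‖)) r hr)
    exact le_iSup (fun ξ : EuclideanSpace ℝ (Fin 3) => ENNReal.ofReal ((1 + ‖ξ‖) ^ 4 * ‖V r ξ‖)) ξ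
  have hdec : ∀ r ∈ Icc 0 F, HasDecay 4 a (V r) := fun r hr =>
    hasDecay_of_weight_mul_norm_le fun ξ =>
      (ENNReal.ofReal_le_iff_le_toReal hAbar_top).1 (hle_Abar r hr ξ)
  -- high frequencies
  have hhigh : ∀ r ∈ Icc 0 F, ∀ ξ, R₁ ≤ ‖ξ‖ → (1 + ‖ξ‖) ^ 4 * ‖V r ξ‖ ≤ A₀ + a / 2 := by
    intro r hr ξ hξ
    have hξ2R : 2 * R ≤ ‖ξ‖ := hR₁.trans hξ
    have hξ0 : 0 < ‖ξ‖ := by linarith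
    set Xb : ℝ := a * ((1 + ‖ξ‖) ^ 4)⁻¹ * (32 * M * vB + 32 * ε * CE * ‖ξ‖) +
      4 * a * ε * CE * (‖ξ‖ ^ 3)⁻¹ with hXb
    have hXb0 : 0 ≤ Xb := by positivity
    have hconv : ∀ r' ∈ Icc 0 F, ∀ j k, ‖fconv (V r' · j) (V r' · k) ξ‖ ≤ Xb :=
      fun r' hr' j k =>
        norm_fconv_le_of_tight (hdec r' hr') hM0 (hlowR r' hr') hε (htight r' hr') hR hξ2R j k
    have hN : ∀ r' ∈ Icc 0 F, ‖nonlin (V r') (V r') ξ‖ ≤ 36 * π * ‖ξ‖ * Xb := fun r' hr' =>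
      norm_nonlin_le_of_fconv_le hXb0 (hconv r' hr')
    -- Duhamel from time `0`
    set D : Fin 3 → ℂ := ∫ r' in (0 : ℝ)..r, heat c ξ (r - r') • nonlin (V r') (V r') ξ with hD
    have hVr : V r ξ = heat c ξ (r - 0) • V 0 ξ - D := h.duhamel le_rfl hr.1 hr.2 ξ
    have hw0 : 0 < (1 + ‖ξ‖) ^ 4 := by positivity
    have h1 : (1 + ‖ξ‖) ^ 4 * ‖V r ξ‖ ≤ A₀ + (1 + ‖ξ‖) ^ 4 * ‖D‖ := by
      rw [hVr]
      calc (1 + ‖ξ‖) ^ 4 * ‖heat c ξ (r - 0) • V 0 ξ - D‖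
          ≤ (1 + ‖ξ‖) ^ 4 * (‖heat c ξ (r - 0) • V 0 ξ‖ + ‖D‖) :=
            mul_le_mul_of_nonneg_left (norm_sub_le _ _) hw0.le
        _ = (1 + ‖ξ‖) ^ 4 * (heat c ξ (r - 0) * ‖V 0 ξ‖) + (1 + ‖ξ‖) ^ 4 * ‖D‖ := by
            rw [norm_heat_smul]; ring
        _ ≤ (1 + ‖ξ‖) ^ 4 * ‖V 0 ξ‖ + (1 + ‖ξ‖) ^ 4 * ‖D‖ := by
            gcongr
            exact mul_le_of_le_one_left (norm_nonneg _) (heat_le_one hc.le (by linarith [hr.1]) ξ)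
        _ ≤ A₀ + (1 + ‖ξ‖) ^ 4 * ‖D‖ := by
            gcongr
            exact weight_mul_norm_le hA₀ ξ
    -- the Duhamel term
    have hD1 : ‖D‖ ≤ ∫ r' in (0 : ℝ)..r, heat c ξ (r - r') * ‖nonlin (V r') (V r') ξ‖ :=
      (intervalIntegral.norm_integral_le_integral_norm hr.1).trans_eq
        (intervalIntegral.integral_congr fun r' _ => by simp only [norm_heat_smul])
    have hcont1 : Continuous fun r' => heat c ξ (r - r') * ‖nonlin (V r') (V r') ξ‖ :=
      (continuous_heat_comp c continuous_const (continuous_const.sub continuous_id)).mul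
        (h.continuous_nonlin_time ξ).norm
    have hcont2 : Continuous fun r' => heat c ξ (r - r') * (36 * π * ‖ξ‖ * Xb) :=
      (continuous_heat_comp c continuous_const (continuous_const.sub continuous_id)).mul
        continuous_const
    have hD2 : ∫ r' in (0 : ℝ)..r, heat c ξ (r - r') * ‖nonlin (V r') (V r') ξ‖ ≤
        ∫ r' in (0 : ℝ)..r, heat c ξ (r - r') * (36 * π * ‖ξ‖ * Xb) :=
      intervalIntegral.integral_mono_on hr.1 (hcont1.intervalIntegrable _ _)
        (hcont2.intervalIntegrable _ _) fun r' hr' =>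
          mul_le_mul_of_nonneg_left (hN r' ⟨hr'.1, hr'.2.trans hr.2⟩) (heat_nonneg _ _ _)
    have hheat : ∫ r' in (0 : ℝ)..r, heat c ξ (r - r') ≤ (c * ‖ξ‖ ^ 2)⁻¹ := by
      have := mul_norm_sq_mul_integral_heat_le c ξ 0 r
      rw [← one_div, le_div_iff₀' (by positivity)]
      exact this
    have hDle : ‖D‖ ≤ (c * ‖ξ‖ ^ 2)⁻¹ * (36 * π * ‖ξ‖ * Xb) := by
      calc ‖D‖ ≤ _ := hD1
        _ ≤ _ := hD2
        _ = (∫ r' in (0 : ℝ)..r, heat c ξ (r - r')) * (36 * π * ‖ξ‖ * Xb) :=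
            intervalIntegral.integral_mul_const _ _
        _ ≤ (c * ‖ξ‖ ^ 2)⁻¹ * (36 * π * ‖ξ‖ * Xb) :=
            mul_le_mul_of_nonneg_right hheat (by positivity)
    have habs : (1 + ‖ξ‖) ^ 4 * ((c * ‖ξ‖ ^ 2)⁻¹ * (36 * π * ‖ξ‖ * Xb)) ≤ a / 2 :=
      absorb_le_half hc hR₁1 hξ ha0 hε hCE0 hεc hR₁'
    calc (1 + ‖ξ‖) ^ 4 * ‖V r ξ‖ ≤ A₀ + (1 + ‖ξ‖) ^ 4 * ‖D‖ := h1
      _ ≤ A₀ + (1 + ‖ξ‖) ^ 4 * ((c * ‖ξ‖ ^ 2)⁻¹ * (36 * π * ‖ξ‖ * Xb)) := by gcongr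
      _ ≤ A₀ + a / 2 := by linarith
  -- low frequencies
  have hlow4 : ∀ r ∈ Icc 0 F, ∀ ξ, ‖ξ‖ < R₁ →
      (1 + ‖ξ‖) ^ 4 * ‖V r ξ‖ ≤ (1 + R₁) ^ 4 * (A₀ + 36 * π * R₁ * Λ * Tw) := by
    intro r hr ξ hξ
    have h1 : (1 + ‖ξ‖) ^ 4 ≤ (1 + R₁) ^ 4 :=
      pow_le_pow_left₀ (by positivity) (by linarith) 4
    have h2 : ‖V r ξ‖ ≤ A₀ + 36 * π * R₁ * Λ * Tw := by
      refine (hlow r hr ξ).trans ?_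
      have : 36 * π * ‖ξ‖ * Λ * Tw ≤ 36 * π * R₁ * Λ * Tw := by gcongr
      linarith
    exact mul_le_mul h1 h2 (norm_nonneg _) (by positivity)
  -- everywhere, then absorb the supremum
  have hmain : ∀ r ∈ Icc 0 F, ∀ ξ, (1 + ‖ξ‖) ^ 4 * ‖V r ξ‖ ≤ B + a / 2 := by
    intro r hr ξ
    rcases le_or_gt R₁ ‖ξ‖ with hξ | hξ
    · linarith [hhigh r hr ξ hξ]
    · have := hlow4 r hr ξ hξ
      have hle : (1 + R₁) ^ 4 * (A₀ + 36 * π * R₁ * Λ * Tw) ≤ B := by rw [hB]; linarith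
      linarith
  have hAbar2 : Abar ≤ ENNReal.ofReal (B + a / 2) :=
    iSup₂_le fun r hr => iSup_le fun ξ => ENNReal.ofReal_le_ofReal (hmain r hr ξ)
  have ha_le : a ≤ B + a / 2 := ENNReal.toReal_le_of_le_ofReal (by positivity) hAbar2
  have ha2 : a ≤ 2 * B := by linarith
  intro r hr
  exact (hdec r hr).mono ha2

end Summit.NavierStokesRegularity.NavierStokesRegularity.Theorems.TightEnvelope

end
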